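import Summits.CriticalPhenomena.PercolationContinuityZ3.Theorems.Transplant.CayleySkeletonSign
import HarnessLib

/-!
# The KERNEL CRITERION for connected cylinders / strips on a Cayley graph: if the generators lying in `ker φ` generate `ker φ`, the
# cylinders `{‖φ‖_∞ ≤ ℓ}` of `Cay(Γ; S)` are connected (every `ℓ`) — the last hypothesis of `CayleyNeg` / `CayleySign` / `CayleyLine`
# becomes group-theoretic

builds on p205010 (kernel theorem, internal audit signed; external expert review pending) — nothing in this file uses p205010.
Lane `prim-bschramm`, seat `prim-bschramm-p4` (gen 9; PART C3, METHOD = abstract closing argument); helper file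
(`--supports stmt-CriticalPhenomena-4575 --as helper`).  Memo `HOME/bschramm/P4-GENERAL.md` §25.  Companion of `CayleySkeletonSign`.

THE POINT.  `CayleySign.criticalContinuity` asks for connected induced cylinders `{g | φ g ∈ Λ_ℓ}` in `Cay(Γ; S)`; the hand-rolled rows
of the lane proved this by explicit walks (commutator staircases for `H₃(ℤ)`, …).  Here: (K1) right multiplication by the subgroup
generated by any `T ⊆ S` under which a vertex set `A` is invariant moves inside ONE connected component of the induced graph `Cay[A]`
(`reachable_mul_of_mem_closure`, closure induction); (K2) inside a cylinder every vertex descends to the fibre `φ = 0` along the unit-step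
generators `s₀, s₁` without leaving the cylinder (`exists_reachable_ker`, induction on `|φ₀| + |φ₁|`); hence (K3) **if `S ∩ ker φ` generates
`ker φ`, every cylinder is connected** (`cyl_connected_of_ker_generated`), and the one-dimensional analogue for strips of an additive
height (`strip_connected_of_ker_generated`).  For nilpotent `Γ` this is a finite check on generators (e.g. `H₃(ℤ) × ℤ` over `φ = (x, t)`:
`ker φ = ⟨b, c⟩`, so any `S ∋ b^±, c^±` qualifies — file `CayleySkeletonCustomers`).
* §1 `reachable_mul_of_mem_closure` (K1); §2 `exists_reachable_ker` (K2), **`cyl_connected_of_ker_generated`** (K3);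
* §3 `exists_reachable_ker_line`, **`strip_connected_of_ker_generated`**.
[cite: BenjaminiSchramm1996, §2 (Cayley graphs)] [cite: GrimmettPercolation1999, §12.1 p. 349]
-/

noncomputable section

namespace Summit.CriticalPhenomena.PercolationContinuityZ3.Theorems.Transplant

open Literature.Probability.LatticeModels SimpleGraph
open scoped Classical

namespace CayleyKernel

variable {Γ : Type} [Group Γ] (S : Finset Γ)

/-! ## §1 (K1) Right multiplication by `⟨T⟩`, `T ⊆ S`, stays in one component of an invariant induced subgraph -/

/-- **(K1)** Let `T ⊆ S` and let `A ⊆ Γ` be invariant under right multiplication by `T` (`h ∈ A ↔ h·t ∈ A`).  Then for every `g` in the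
subgroup generated by `T` and every `h ∈ A`: `h·g ∈ A` and `h·g` is joined to `h` inside the induced graph `Cay(Γ;S)[A]`.
[cite: BenjaminiSchramm1996, §2 (Cayley graphs)] -/
theorem reachable_mul_of_mem_closure {T : Finset Γ} (hTS : T ⊆ S) {A : Set Γ} (hA : ∀ t ∈ T, ∀ h : Γ, h ∈ A ↔ h * t ∈ A)
    {g : Γ} (hg : g ∈ Subgroup.closure (T : Set Γ)) :
    (∀ h : Γ, h ∈ A ↔ h * g ∈ A) ∧
      ∀ (h : Γ) (hh : h ∈ A) (hhg : h * g ∈ A), ((mulCayley (S : Set Γ)).induce A).Reachable ⟨h, hh⟩ ⟨h * g, hhg⟩ := by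
  induction hg using Subgroup.closure_induction with
  | mem t ht =>
    have ht' : t ∈ T := Finset.mem_coe.1 ht
    refine ⟨hA t ht', fun h hh hht => ?_⟩
    by_cases e : h * t = h
    · have : (⟨h * t, hht⟩ : A) = ⟨h, hh⟩ := Subtype.ext e
      rw [this]
    · refine Adj.reachable ?_
      simp only [comap_adj, Function.Embedding.subtype_apply]
      rw [mulCayley_adj]
      exact ⟨Ne.symm e, Or.inl (by rw [inv_mul_cancel_left]; exact Finset.mem_coe.2 (hTS ht'))⟩
  | one =>
    refine ⟨fun h => by rw [mul_one], fun h hh hhg => ?_⟩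
    have : (⟨h * 1, hhg⟩ : A) = ⟨h, hh⟩ := Subtype.ext (mul_one h)
    rw [this]
  | mul x y _ _ ihx ihy =>
    refine ⟨fun h => (ihx.1 h).trans (by rw [ihy.1 (h * x), mul_assoc]), fun h hh hhg => ?_⟩
    have hx : h * x ∈ A := (ihx.1 h).1 hh
    have hxy : h * x * y ∈ A := by rw [mul_assoc]; exact hhg
    have e : (⟨h * (x * y), hhg⟩ : A) = ⟨h * x * y, hxy⟩ := Subtype.ext (mul_assoc h x y).symm
    rw [e]
    exact (ihx.2 h hh hx).trans (ihy.2 (h * x) hx hxy)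
  | inv x _ ihx =>
    refine ⟨fun h => ?_, fun h hh hhg => ?_⟩
    · rw [ihx.1 (h * x⁻¹), inv_mul_cancel_right]
    · have e : (⟨h, hh⟩ : A) = ⟨h * x⁻¹ * x, by rw [inv_mul_cancel_right]; exact hh⟩ :=
        Subtype.ext (inv_mul_cancel_right h x).symm
      rw [e]
      exact (ihx.2 (h * x⁻¹) hhg _).symm

/-! ## §2 (K2) Descent to the fibre `φ = 0` inside a cylinder; (K3) the kernel criterion -/

variable {S}

/-- One descending step in coordinate `i`: from `g` with `φ(g)_i ≠ 0` to a neighbour `g·s_i^{∓1}` with `|φ_i|` one smaller, the other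
coordinate unchanged. [folklore] -/
theorem exists_adj_natAbs_lt (φ : Γ → Site 2) (map_mul : ∀ g h : Γ, φ (g * h) = φ g + φ h) {i : Fin 2} {s : Γ} (hs : s ∈ S)
    (hφs : φ s = Pi.single i 1) (g : Γ) (hg : φ g i ≠ 0) :
    ∃ g' : Γ, (mulCayley (S : Set Γ)).Adj g g' ∧ (φ g' i).natAbs + 1 = (φ g i).natAbs ∧ ∀ j, j ≠ i → φ g' j = φ g j := by
  have φ_one : φ 1 = 0 := by
    have h := map_mul 1 1
    rw [one_mul] at h
    exact add_eq_left.1 h.symm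
  have φ_inv : ∀ g, φ g⁻¹ = -φ g := fun g => by
    have h := map_mul g⁻¹ g
    rw [inv_mul_cancel, φ_one] at h
    exact eq_neg_of_add_eq_zero_left h.symm
  have hs1 : s ≠ 1 := by
    intro h; have h0 := congrFun hφs i; rw [h, φ_one] at h0; simp at h0
  rcases lt_or_gt_of_ne hg with hlt | hgt
  · -- φ g i < 0: go up by s
    refine ⟨g * s, ?_, ?_, fun j hj => ?_⟩
    · rw [mulCayley_adj]
      refine ⟨fun h => hs1 (mul_left_cancel (a := g) (by rw [mul_one]; exact h.symm)), Or.inl ?_⟩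
      rw [inv_mul_cancel_left]; exact Finset.mem_coe.2 hs
    · rw [map_mul, hφs, Pi.add_apply, Pi.single_eq_same]; omega
    · rw [map_mul, hφs, Pi.add_apply, Pi.single_eq_of_ne hj, add_zero]
  · -- φ g i > 0: go down by s⁻¹
    refine ⟨g * s⁻¹, ?_, ?_, fun j hj => ?_⟩
    · rw [mulCayley_adj]
      refine ⟨fun h => hs1 (inv_eq_one.1 (mul_left_cancel (a := g) (by rw [mul_one]; exact h.symm))), Or.inr ?_⟩
      rw [mul_inv_rev, inv_inv, inv_mul_cancel_right]; exact Finset.mem_coe.2 hs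
    · rw [map_mul, φ_inv, hφs, Pi.add_apply, Pi.neg_apply, Pi.single_eq_same]; omega
    · rw [map_mul, φ_inv, hφs, Pi.add_apply, Pi.neg_apply, Pi.single_eq_of_ne hj, neg_zero, add_zero]

/-- **(K2)** Inside the cylinder `{φ ∈ Λ_ℓ}` every vertex is joined to a vertex of the fibre `φ = 0` (descend along `s₀^{∓1}`, then
`s₁^{∓1}`; `|φ₀| + |φ₁|` drops at each step and the box is never left). [folklore] -/
theorem exists_reachable_ker (φ : Γ → Site 2) (map_mul : ∀ g h : Γ, φ (g * h) = φ g + φ h)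
    (step : ∀ i : Fin 2, ∃ s ∈ S, φ s = Pi.single i 1) (ℓ : ℕ) :
    ∀ (n : ℕ) (g : Γ) (hg : φ g ∈ box 2 ℓ), (φ g 0).natAbs + (φ g 1).natAbs = n →
      ∃ (g' : Γ) (hg' : φ g' ∈ box 2 ℓ), φ g' = 0 ∧
        ((mulCayley (S : Set Γ)).induce {g | φ g ∈ box 2 ℓ}).Reachable ⟨g, hg⟩ ⟨g', hg'⟩ := by
  intro n
  induction n with
  | zero =>
    intro g hg hn
    refine ⟨g, hg, ?_, Reachable.refl _⟩
    funext j
    fin_cases j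
    · show φ g 0 = 0; omega
    · show φ g 1 = 0; omega
  | succ n ih =>
    intro g hg hn
    -- pick a coordinate with φ g i ≠ 0
    obtain ⟨i, hi⟩ : ∃ i : Fin 2, φ g i ≠ 0 := by
      by_contra h
      have h' : ∀ i, φ g i = 0 := fun i => by_contra fun hi => h ⟨i, hi⟩
      rw [h' 0, h' 1] at hn
      simp at hn
    obtain ⟨s, hs, hφs⟩ := step i
    obtain ⟨g₁, hadj, hlt, hother⟩ := exists_adj_natAbs_lt φ map_mul hs hφs g hi
    have hbox : ∀ j, |φ g j| ≤ ℓ := fun j => abs_le.2 (mem_box.1 hg j)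
    have hg₁ : φ g₁ ∈ box 2 ℓ := by
      rw [mem_box]
      intro j
      by_cases hj : j = i
      · subst hj
        have h1 : |φ g₁ j| ≤ |φ g j| := by
          rw [Int.abs_eq_natAbs, Int.abs_eq_natAbs]; exact_mod_cast (by omega : (φ g₁ j).natAbs ≤ (φ g j).natAbs)
        exact abs_le.1 (h1.trans (hbox j))
      · rw [hother j hj]; exact mem_box.1 hg j
    have hn₁ : (φ g₁ 0).natAbs + (φ g₁ 1).natAbs = n := by
      fin_cases i
      · have h0 := hother 1 (by decide)
        simp only [Fin.zero_eta] at hlt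
        rw [h0]; omega
      · have h0 := hother 0 (by decide)
        simp only [Fin.mk_one] at hlt
        rw [h0]; omega
    obtain ⟨g', hg', h0, hreach⟩ := ih g₁ hg₁ hn₁
    refine ⟨g', hg', h0, (Adj.reachable ?_).trans hreach⟩
    simp only [comap_adj, Function.Embedding.subtype_apply]
    exact hadj

/-- **(K3) THE KERNEL CRITERION**: if the generators lying in `ker φ` generate `ker φ`, every cylinder `{φ ∈ Λ_ℓ}` of `Cay(Γ; S)` is
connected (additive `φ` with unit-step generators). [cite: BenjaminiSchramm1996, §2 (Cayley graphs)] -/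
theorem cyl_connected_of_ker_generated (φ : Γ → Site 2) (map_mul : ∀ g h : Γ, φ (g * h) = φ g + φ h)
    (step : ∀ i : Fin 2, ∃ s ∈ S, φ s = Pi.single i 1)
    (hker : ∀ g : Γ, φ g = 0 → g ∈ Subgroup.closure (↑(S.filter fun s => φ s = 0) : Set Γ)) (ℓ : ℕ) :
    ((mulCayley (S : Set Γ)).induce {g | φ g ∈ box 2 ℓ}).Connected := by
  have φ_one : φ 1 = 0 := by
    have h := map_mul 1 1
    rw [one_mul] at h
    exact add_eq_left.1 h.symm
  have h1 : (1 : Γ) ∈ {g | φ g ∈ box 2 ℓ} := by show φ 1 ∈ box 2 ℓ; rw [φ_one]; exact zero_mem_box 2 ℓ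
  have hA : ∀ t ∈ S.filter (fun s => φ s = 0), ∀ h : Γ, h ∈ {g | φ g ∈ box 2 ℓ} ↔ h * t ∈ {g | φ g ∈ box 2 ℓ} := by
    intro t ht h
    rw [Finset.mem_filter] at ht
    show φ h ∈ box 2 ℓ ↔ φ (h * t) ∈ box 2 ℓ
    rw [map_mul, ht.2, add_zero]
  refine (connected_iff _).2 ⟨fun a b => ?_, ⟨⟨1, h1⟩⟩⟩
  suffices hr : ∀ a : {g | φ g ∈ box 2 ℓ}, ((mulCayley (S : Set Γ)).induce {g | φ g ∈ box 2 ℓ}).Reachable a ⟨1, h1⟩ from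
    (hr a).trans (hr b).symm
  intro a
  obtain ⟨g', hg', h0, hreach⟩ := exists_reachable_ker φ map_mul step ℓ _ a.1 a.2 rfl
  have hK := reachable_mul_of_mem_closure S (Finset.filter_subset _ S) hA (hker g' h0)
  have h2 := hK.2 1 h1 (by rw [one_mul]; exact hg')
  have e : (⟨1 * g', by rw [one_mul]; exact hg'⟩ : {g | φ g ∈ box 2 ℓ}) = ⟨g', hg'⟩ := Subtype.ext (one_mul g')
  rw [e] at h2
  exact hreach.trans h2.symm

/-! ## §3 The one-dimensional analogue: strips of an additive height -/

/-- (K2) for a height `ψ : Γ → ℤ`: inside the strip `{|ψ| ≤ ℓ}` every vertex is joined to a vertex of `ker ψ`. [folklore] -/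
theorem exists_reachable_ker_line (ψ : Γ → ℤ) (map_mul : ∀ g h : Γ, ψ (g * h) = ψ g + ψ h) {s : Γ} (hs : s ∈ S) (hψs : ψ s = 1)
    (ℓ : ℕ) : ∀ (n : ℕ) (g : Γ) (hg : |ψ g| ≤ ℓ), (ψ g).natAbs = n →
      ∃ (g' : Γ) (hg' : |ψ g'| ≤ ℓ), ψ g' = 0 ∧ ((mulCayley (S : Set Γ)).induce {g | |ψ g| ≤ ℓ}).Reachable ⟨g, hg⟩ ⟨g', hg'⟩ := by
  have ψ_one : ψ 1 = 0 := by have h := map_mul 1 1; rw [one_mul] at h; linarith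
  have ψ_inv : ∀ g, ψ g⁻¹ = -ψ g := fun g => by have h := map_mul g⁻¹ g; rw [inv_mul_cancel, ψ_one] at h; linarith
  have hs1 : s ≠ 1 := by intro h; rw [h, ψ_one] at hψs; exact zero_ne_one hψs
  intro n
  induction n with
  | zero => intro g hg hn; exact ⟨g, hg, by omega, Reachable.refl _⟩
  | succ n ih =>
    intro g hg hn
    rcases lt_or_gt_of_ne (show ψ g ≠ 0 by omega) with hlt | hgt
    · have hg₁ : |ψ (g * s)| ≤ ℓ := by rw [map_mul, hψs, abs_le]; constructor <;> [linarith [abs_le.1 hg]; omega]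
      obtain ⟨g', hg', h0, hr⟩ := ih (g * s) hg₁ (by rw [map_mul, hψs]; omega)
      refine ⟨g', hg', h0, (Adj.reachable ?_).trans hr⟩
      simp only [comap_adj, Function.Embedding.subtype_apply]
      rw [mulCayley_adj]
      refine ⟨fun h => hs1 (mul_left_cancel (a := g) (by rw [mul_one]; exact h.symm)), Or.inl ?_⟩
      rw [inv_mul_cancel_left]; exact Finset.mem_coe.2 hs
    · have hg₁ : |ψ (g * s⁻¹)| ≤ ℓ := by rw [map_mul, ψ_inv, hψs, abs_le]; constructor <;> [omega; linarith [abs_le.1 hg]]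
      obtain ⟨g', hg', h0, hr⟩ := ih (g * s⁻¹) hg₁ (by rw [map_mul, ψ_inv, hψs]; omega)
      refine ⟨g', hg', h0, (Adj.reachable ?_).trans hr⟩
      simp only [comap_adj, Function.Embedding.subtype_apply]
      rw [mulCayley_adj]
      refine ⟨fun h => hs1 (inv_eq_one.1 (mul_left_cancel (a := g) (by rw [mul_one]; exact h.symm))), Or.inr ?_⟩
      rw [mul_inv_rev, inv_inv, inv_mul_cancel_right]; exact Finset.mem_coe.2 hs

/-- **THE KERNEL CRITERION FOR STRIPS**: if the generators of height `0` generate `ker ψ`, every strip `{|ψ| ≤ ℓ}` of `Cay(Γ; S)` is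
connected. [cite: BenjaminiSchramm1996, §2 (Cayley graphs)] -/
theorem strip_connected_of_ker_generated (ψ : Γ → ℤ) (map_mul : ∀ g h : Γ, ψ (g * h) = ψ g + ψ h) (step : ∃ s ∈ S, ψ s = 1)
    (hker : ∀ g : Γ, ψ g = 0 → g ∈ Subgroup.closure (↑(S.filter fun s => ψ s = 0) : Set Γ)) (ℓ : ℕ) :
    ((mulCayley (S : Set Γ)).induce {g | |ψ g| ≤ ℓ}).Connected := by
  have ψ_one : ψ 1 = 0 := by have h := map_mul 1 1; rw [one_mul] at h; linarith
  have h1 : (1 : Γ) ∈ {g | |ψ g| ≤ (ℓ : ℤ)} := by show |ψ 1| ≤ ℓ; rw [ψ_one, abs_zero]; exact Nat.cast_nonneg ℓ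
  have hA : ∀ t ∈ S.filter (fun s => ψ s = 0), ∀ h : Γ, h ∈ {g | |ψ g| ≤ (ℓ : ℤ)} ↔ h * t ∈ {g | |ψ g| ≤ (ℓ : ℤ)} := by
    intro t ht h
    rw [Finset.mem_filter] at ht
    show |ψ h| ≤ ℓ ↔ |ψ (h * t)| ≤ ℓ
    rw [map_mul, ht.2, add_zero]
  obtain ⟨s, hs, hψs⟩ := step
  refine (connected_iff _).2 ⟨fun a b => ?_, ⟨⟨1, h1⟩⟩⟩
  suffices hr : ∀ a : {g | |ψ g| ≤ (ℓ : ℤ)}, ((mulCayley (S : Set Γ)).induce {g | |ψ g| ≤ (ℓ : ℤ)}).Reachable a ⟨1, h1⟩ from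
    (hr a).trans (hr b).symm
  intro a
  obtain ⟨g', hg', h0, hreach⟩ := exists_reachable_ker_line ψ map_mul hs hψs ℓ _ a.1 a.2 rfl
  have hK := reachable_mul_of_mem_closure S (Finset.filter_subset _ S) hA (hker g' h0)
  have h2 := hK.2 1 h1 (by rw [one_mul]; exact hg')
  have e : (⟨1 * g', by rw [one_mul]; exact hg'⟩ : {g | |ψ g| ≤ (ℓ : ℤ)}) = ⟨g', hg'⟩ := Subtype.ext (one_mul g')
  rw [e] at h2
  exact hreach.trans h2.symm

end CayleyKernel

end Summit.CriticalPhenomena.PercolationContinuityZ3.Theorems.Transplant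

end
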